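import Literature.AlgebraicGeometry.Motives.JacobianGaloisCoverNorm
import Literature.AlgebraicGeometry.Motives.AbelianVarietyBaseChange
import HarnessLib

/-!
# Naturality of the comparison homomorphisms `J(X_L) → J(X) ×_K L` with norm maps, deck sums and Galois-cover traces

Topic `AlgebraicGeometry/Motives`; namespace `Literature.AlgebraicGeometry.Motives.Jacobian`.  PROOF FILE (theorems only; no definition,
no named fact, no instance, no `sorry`).

For a curve (indeed any `K`-scheme) `X` with an Albanese datum `𝒥X : Jacobian X` (the tree's point-free Jacobian, ★ `Motives/Jacobian`:
the pair `(J, diff)` with Milne's universal property) and an Albanese datum `𝒥X' : Jacobian (X ×_K L)` of its base change along a field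
extension `L / K`, a **comparison homomorphism** is any `uX : J(X_L) ⟶ J(X) ×_K L` carrying the difference map of `X_L` to the base change
of the difference map of `X` (`[x − y]' ≫ uX = [x − y]_L`, the hypothesis `hX` below; ★ `Jacobian.exists_hom_baseChange_surjective` constructs
one, ★ `Jacobian.exists_isIsogeny_baseChange_complex` shows it is an ISOGENY over `ℂ` — «formation of the Albanese variety commutes with base
change», [Grothendieck1962FGA6] Thm. 3.3 (iii), in its isogeny form).  This file proves that the comparison homomorphisms INTERTWINE the three
kinds of homomorphisms between Jacobians the tree builds from curve maps:

* `pushforward_baseChange_comm` — NORM MAPS: `Nm_{f_L}' ≫ uY = uX ≫ (Nm_f)_L` for every `f : X ⟶ Y` ([Lange2023AbelianVarietiesComplex] §4.5.2: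
  `N_f` is defined by the universal property, which is compatible with base change; proof = uniqueness out of `J(X_L)` (★ `Jacobian.hom_ext`)
  + `diff ≫ Nm_f = (f × f) ≫ diff` twice + naturality of the monoidal structure `μ` of the base-change functor);
* `sum_pushforward_baseChange_comm`, `zsmul_…`, `comp_baseChange_comm` — sums, integer multiples and composites of intertwined maps are
  intertwined (`Hom.baseChange` is an additive functor, ★ `Hom.baseChange_add/_comp`);
* **`trace_baseChange_comm`** — GALOIS-COVER TRACES in the tree's def-free currency ([LangeRodriguez2022] §3.5.1 Prop. 3.5.1 `Nm_G = p^* ∘ Nm_p`: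
  `t` is «`p^*`» iff `Nm_p ≫ t = Σ_{δ ∈ Δ} (δ)_*`, ★ Q1 `JacobianGaloisCoverNorm`): if `t` over `K` and `t'` over `L` are so pinned for a cover
  `p : X → Y = X/Δ` and its base change, then `t' ≫ uX = uY ≫ t_L` — precompose with `Nm'_{p_L}`, rewrite both sides to `uX ≫ (Σ_δ (δ)_*)_L` by
  the two pinnings and the norm-map naturality, and cancel `Nm'_{p_L}` (right-cancellable for a quotient map: ★ `Jacobian.eq_of_pushforward_comp_eq`;
  stated with an abstract cancellation hypothesis and in the `IsSepQuotient` / algebraically-closed forms);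
* `pushPull_baseChange_comm` — the push–pull words `t ≫ Σ_i Nm_{g_i}` (the shape of the finite-level Hecke endomorphism, ★
  `AppendixC.HeckeEndomorphismPushPull`) are intertwined.

Cell `hodgecm-mathlib` (D-0151), crux `HLiu418` = stmt-HodgeConjecture-24832, d6 line, road (P) / (J-isog) leg **(J-a)** (director g11 RULING
s213 (1)(a); A-plan2 (g12) hand 2026-08-30): the Hecke generators on the complex Jacobians `J(E_c ⊗ ℂ)` and on `J(E_c) ⊗ ℂ` correspond along
the comparison isogenies, so a positive anti-involution transports ((J-b)/(J-c), other hands).  Degree `1` of `u` is never used.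
COUNT-NEUTRAL capital: HC_CM is proved only modulo the 7 printed citations until rung 0 closes; this file discharges none of them.

## References
* [Grothendieck1962FGA6] A. Grothendieck, FGA VI, *Les schémas de Picard: propriétés générales* (Sém. Bourbaki 236, 1962), Thm. 3.3 (iii).
* [Lange2023AbelianVarietiesComplex] H. Lange, *Abelian Varieties over the Complex Numbers* (2023), §4.5.2 (the norm map `N_f`), Thm. 4.5.1.
* [LangeRodriguez2022] H. Lange, R. E. Rodríguez, *Decomposition of Jacobians by Prym Varieties*, LNM 2310 (2022), §3.5.1 Prop. 3.5.1 (p. 65).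
* [Milne1986JacobianVarieties] J. S. Milne, *Jacobian Varieties* (1986), §6 Prop. 6.1, Prop. 6.4, Remark 6.5.
* [MumfordAV1970] D. Mumford, *Abelian Varieties* (1970), §7 Thm. p. 66 (quotients by finite groups).
-/

set_option autoImplicit false

noncomputable section

open CategoryTheory CategoryTheory.Limits AlgebraicGeometry MonoidalCategory CartesianMonoidalCategory

universe u v

namespace Literature.AlgebraicGeometry.Motives

open AbelianVariety (bcSpec bcFunctor)

-- the group scheme underlying `A.baseChange L` is `(bcFunctor K L).obj A.X` only up to unfolding `AbelianVariety.baseChange`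
-- (as in ★ `AlbaneseDimensionBaseChange`)
set_option backward.isDefEq.respectTransparency false

/-! ## §0 Bookkeeping: base change of sums and integer multiples of homomorphisms -/

namespace AbelianVariety

variable {K : Type u} [Field K] (L : Type u) [Field L] [Algebra K L] {A B : AbelianVariety K}

/-- `(Σ_{i ∈ s} f_i)_L = Σ_{i ∈ s} (f_i)_L` (additivity of base change, ★ `Hom.baseChange_add`; plumbing). [folklore] -/
private theorem Hom.baseChange_sum {ι : Type*} (s : Finset ι) (f : ι → (A ⟶ B)) :
    Hom.baseChange L (∑ i ∈ s, f i) = ∑ i ∈ s, Hom.baseChange L (f i) :=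
  map_sum (AddMonoidHom.mk' (fun g : A ⟶ B => Hom.baseChange L g) (Hom.baseChange_add L)) f s

/-- `(n • f)_L = n • f_L` for `n : ℤ` (additivity of base change; plumbing). [folklore] -/
private theorem Hom.baseChange_zsmul (n : ℤ) (f : A ⟶ B) : Hom.baseChange L (n • f) = n • Hom.baseChange L f :=
  map_zsmul (AddMonoidHom.mk' (fun g : A ⟶ B => Hom.baseChange L g) (Hom.baseChange_add L)) n f

end AbelianVariety

namespace Jacobian

variable {K : Type u} [Field K] (L : Type u) [Field L] [Algebra K L]
variable {X Y Z : SchemeOver K} (𝒥X : Jacobian X) (𝒥Y : Jacobian Y) (𝒥Z : Jacobian Z)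
  (𝒥X' : Jacobian ((bcFunctor K L).obj X)) (𝒥Y' : Jacobian ((bcFunctor K L).obj Y)) (𝒥Z' : Jacobian ((bcFunctor K L).obj Z))
  (uX : 𝒥X'.J ⟶ 𝒥X.J.baseChange L) (uY : 𝒥Y'.J ⟶ 𝒥Y.J.baseChange L) (uZ : 𝒥Z'.J ⟶ 𝒥Z.J.baseChange L)

/-! ## §1 Norm maps: `Nm'_{f_L} ≫ uY = uX ≫ (Nm_f)_L` -/

/-- **The comparison homomorphisms intertwine the norm maps**: for `f : X ⟶ Y` and comparison homomorphisms `uX`, `uY` (difference-map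
compatible, `hX`, `hY`), `Nm'_{f_L} ≫ uY = uX ≫ (Nm_f)_L`.  Both sides are homomorphisms out of `J(X_L)` whose composite with `[x − y]'` is
`(f_L × f_L) ≫ [x − y]_{Y,L}`: for the left side by ★ `diff_comp_pushforward` (on `X_L`) and `hY`; for the right side by `hX`,
★ `diff_comp_pushforward` (on `X`, base-changed) and the naturality of the monoidal structure `μ` of `(−) ×_K L`
(Mathlib `Functor.LaxMonoidal.μ_natural`); conclude by ★ `Jacobian.hom_ext`. [cite: Lange2023AbelianVarietiesComplex, §4.5.2 (the norm map N_f) and Thm. 4.5.1]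
[cite: Milne1986JacobianVarieties, §6 Prop. 6.4 and Remark 6.5] [cite: Grothendieck1962FGA6, Thm. 3.3 (iii)] -/
theorem pushforward_baseChange_comm
    (hX : 𝒥X'.diff ≫ uX.hom.hom.hom = (Functor.Monoidal.μIso (bcFunctor K L) X X).hom ≫ (bcFunctor K L).map 𝒥X.diff)
    (hY : 𝒥Y'.diff ≫ uY.hom.hom.hom = (Functor.Monoidal.μIso (bcFunctor K L) Y Y).hom ≫ (bcFunctor K L).map 𝒥Y.diff)
    (f : X ⟶ Y) :
    𝒥X'.pushforward 𝒥Y' ((bcFunctor K L).map f) ≫ uY = uX ≫ AbelianVariety.Hom.baseChange L (𝒥X.pushforward 𝒥Y f) := by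
  apply 𝒥X'.hom_ext
  change 𝒥X'.diff ≫ (𝒥X'.pushforward 𝒥Y' ((bcFunctor K L).map f)).hom.hom.hom ≫ uY.hom.hom.hom =
    𝒥X'.diff ≫ uX.hom.hom.hom ≫ (AbelianVariety.Hom.baseChange L (𝒥X.pushforward 𝒥Y f)).hom.hom.hom
  have lhs : 𝒥X'.diff ≫ (𝒥X'.pushforward 𝒥Y' ((bcFunctor K L).map f)).hom.hom.hom ≫ uY.hom.hom.hom =
      Functor.LaxMonoidal.μ (bcFunctor K L) X X ≫ (bcFunctor K L).map ((f ⊗ₘ f) ≫ 𝒥Y.diff) := by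
    rw [𝒥X'.diff_comp_pushforward_assoc, hY, Functor.Monoidal.μIso_hom, Functor.LaxMonoidal.μ_natural_assoc,
      ← Functor.map_comp]
  have rhs : 𝒥X'.diff ≫ uX.hom.hom.hom ≫ (AbelianVariety.Hom.baseChange L (𝒥X.pushforward 𝒥Y f)).hom.hom.hom =
      Functor.LaxMonoidal.μ (bcFunctor K L) X X ≫ (bcFunctor K L).map (𝒥X.diff ≫ (𝒥X.pushforward 𝒥Y f).hom.hom.hom) := by
    rw [← Category.assoc, hX, Functor.Monoidal.μIso_hom, Category.assoc, AbelianVariety.Hom.baseChange_hom_hom_hom,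
      Functor.map_comp]
  rw [lhs, rhs, 𝒥X.diff_comp_pushforward]

/-! ## §2 Sums, integer multiples, composites of intertwined homomorphisms -/

section Words

variable {L}
variable {𝒥X 𝒥Y 𝒥Z 𝒥X' 𝒥Y' 𝒥Z' uX uY uZ}

/-- Composites of intertwined homomorphisms are intertwined: `x' ≫ uY = uX ≫ x_L` and `y' ≫ uZ = uY ≫ y_L` give
`(x' ≫ y') ≫ uZ = uX ≫ (x ≫ y)_L` (★ `Hom.baseChange_comp`) — the comparison maps of [Grothendieck1962FGA6] Thm. 3.3 (iii) are natural
transformations, so the intertwined homomorphisms form a subcategory. [cite: Grothendieck1962FGA6, Thm. 3.3 (iii)] -/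
theorem comp_baseChange_comm {x : 𝒥X.J ⟶ 𝒥Y.J} {x' : 𝒥X'.J ⟶ 𝒥Y'.J} {y : 𝒥Y.J ⟶ 𝒥Z.J} {y' : 𝒥Y'.J ⟶ 𝒥Z'.J}
    (hx : x' ≫ uY = uX ≫ AbelianVariety.Hom.baseChange L x) (hy : y' ≫ uZ = uY ≫ AbelianVariety.Hom.baseChange L y) :
    (x' ≫ y') ≫ uZ = uX ≫ AbelianVariety.Hom.baseChange L (x ≫ y) := by
  rw [Category.assoc, hy, ← Category.assoc, hx, Category.assoc, AbelianVariety.Hom.baseChange_comp]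

/-- Finite sums of intertwined homomorphisms are intertwined (base change of homomorphisms is additive, ★ `Hom.baseChange_add`; the
intertwined homomorphisms form an additive subcategory). [cite: Grothendieck1962FGA6, Thm. 3.3 (iii)] -/
theorem sum_baseChange_comm {ι : Type*} (s : Finset ι) {x : ι → (𝒥X.J ⟶ 𝒥Y.J)} {x' : ι → (𝒥X'.J ⟶ 𝒥Y'.J)}
    (h : ∀ i ∈ s, x' i ≫ uY = uX ≫ AbelianVariety.Hom.baseChange L (x i)) :
    (∑ i ∈ s, x' i) ≫ uY = uX ≫ AbelianVariety.Hom.baseChange L (∑ i ∈ s, x i) := by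
  rw [Preadditive.sum_comp, AbelianVariety.Hom.baseChange_sum, Preadditive.comp_sum]
  exact Finset.sum_congr rfl h

/-- Integer multiples of intertwined homomorphisms are intertwined. [cite: Grothendieck1962FGA6, Thm. 3.3 (iii)] -/
theorem zsmul_baseChange_comm (n : ℤ) {x : 𝒥X.J ⟶ 𝒥Y.J} {x' : 𝒥X'.J ⟶ 𝒥Y'.J}
    (h : x' ≫ uY = uX ≫ AbelianVariety.Hom.baseChange L x) :
    (n • x') ≫ uY = uX ≫ AbelianVariety.Hom.baseChange L (n • x) := by
  rw [Preadditive.zsmul_comp, h, AbelianVariety.Hom.baseChange_zsmul, Preadditive.comp_zsmul]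

/-- The identity is intertwined (★ `Hom.baseChange_id`). [cite: Grothendieck1962FGA6, Thm. 3.3 (iii)] -/
theorem id_baseChange_comm : 𝟙 𝒥X'.J ≫ uX = uX ≫ AbelianVariety.Hom.baseChange L (𝟙 𝒥X.J) := by
  rw [Category.id_comp, AbelianVariety.Hom.baseChange_id, Category.comp_id]

end Words

/-- **Sums of norm maps along automorphisms are intertwined**: for a finite family `act` of automorphisms of `X`,
`(Σ_δ Nm'_{(act δ)_L}) ≫ uX = uX ≫ (Σ_δ Nm_{act δ})_L` (§1 termwise). [cite: Lange2023AbelianVarietiesComplex, §4.5.2 (the norm map N_f)]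
[cite: LangeRodriguez2022, §3.5.1 Prop. 3.5.1 (p. 65)] -/
theorem sum_pushforward_baseChange_comm
    (hX : 𝒥X'.diff ≫ uX.hom.hom.hom = (Functor.Monoidal.μIso (bcFunctor K L) X X).hom ≫ (bcFunctor K L).map 𝒥X.diff)
    {Δ : Type v} [Fintype Δ] (act : Δ → (X ≅ X)) :
    (∑ δ, 𝒥X'.pushforward 𝒥X' ((bcFunctor K L).map (act δ).hom)) ≫ uX =
      uX ≫ AbelianVariety.Hom.baseChange L (∑ δ, 𝒥X.pushforward 𝒥X (act δ).hom) :=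
  sum_baseChange_comm Finset.univ fun δ _ => 𝒥X.pushforward_baseChange_comm L 𝒥X 𝒥X' 𝒥X' uX uX hX hX (act δ).hom

/-! ## §3 Galois-cover traces: `t' ≫ uX = uY ≫ t_L` -/

/-- **The comparison homomorphisms intertwine the Galois-cover traces** (def-free `p^*` of ★ `JacobianGaloisCoverNorm`): let `p : X ⟶ Y` and
`act : Δ → Aut X` (finite), `t : J(Y) ⟶ J(X)` with `Nm_p ≫ t = Σ_δ Nm_{act δ}` over `K` and `t' : J(Y_L) ⟶ J(X_L)` with
`Nm'_{p_L} ≫ t' = Σ_δ Nm'_{(act δ)_L}` over `L` ([LangeRodriguez2022] Prop. 3.5.1: both are «`p^*`»).  If `Nm'_{p_L}` is right-cancellable against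
homomorphisms of abelian varieties (`hcancel`; for a quotient map this is ★ `Jacobian.eq_of_pushforward_comp_eq`, see the corollaries), then
`t' ≫ uX = uY ≫ t_L`.  Proof: `Nm' ≫ t' ≫ uX = (Σ Nm'_{δ_L}) ≫ uX = uX ≫ (Σ Nm_δ)_L = uX ≫ (Nm_p ≫ t)_L = Nm' ≫ uY ≫ t_L` by the two pinnings,
`sum_pushforward_baseChange_comm` and `pushforward_baseChange_comm`; cancel `Nm'`.  The degree of the comparison maps is never used.
[cite: LangeRodriguez2022, §3.5.1 Prop. 3.5.1 (p. 65)] [cite: Lange2023AbelianVarietiesComplex, §4.5.2 and Thm. 4.5.1] [cite: Grothendieck1962FGA6, Thm. 3.3 (iii)] -/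
theorem trace_baseChange_comm
    (hX : 𝒥X'.diff ≫ uX.hom.hom.hom = (Functor.Monoidal.μIso (bcFunctor K L) X X).hom ≫ (bcFunctor K L).map 𝒥X.diff)
    (hY : 𝒥Y'.diff ≫ uY.hom.hom.hom = (Functor.Monoidal.μIso (bcFunctor K L) Y Y).hom ≫ (bcFunctor K L).map 𝒥Y.diff)
    {Δ : Type v} [Fintype Δ] (act : Δ → (X ≅ X)) (p : X ⟶ Y)
    (t : 𝒥Y.J ⟶ 𝒥X.J) (ht : 𝒥X.pushforward 𝒥Y p ≫ t = ∑ δ, 𝒥X.pushforward 𝒥X (act δ).hom)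
    (t' : 𝒥Y'.J ⟶ 𝒥X'.J)
    (ht' : 𝒥X'.pushforward 𝒥Y' ((bcFunctor K L).map p) ≫ t' = ∑ δ, 𝒥X'.pushforward 𝒥X' ((bcFunctor K L).map (act δ).hom))
    (hcancel : ∀ ⦃A : AbelianVariety L⦄ ⦃a b : 𝒥Y'.J ⟶ A⦄,
      𝒥X'.pushforward 𝒥Y' ((bcFunctor K L).map p) ≫ a = 𝒥X'.pushforward 𝒥Y' ((bcFunctor K L).map p) ≫ b → a = b) :
    t' ≫ uX = uY ≫ AbelianVariety.Hom.baseChange L t := by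
  refine hcancel ?_
  rw [← Category.assoc, ht', 𝒥X.sum_pushforward_baseChange_comm L 𝒥X' uX hX act, ← ht, AbelianVariety.Hom.baseChange_comp,
    ← Category.assoc, ← 𝒥X.pushforward_baseChange_comm L 𝒥Y 𝒥X' 𝒥Y' uX uY hX hY p, Category.assoc]

/-- **Galois-cover traces are intertwined — quotient form**: when the base-changed cover `p_L` is a quotient of `X_L` by the base-changed
automorphisms for separated test objects (`IsSepQuotient`; stable under base change of quotients by finite groups, ★
`isSepQuotient_baseChangeHom_of_isProjectiveOver`) and `X_L` has an `L`-point, `Nm'_{p_L}` is right-cancellable (★ `eq_of_pushforward_comp_eq`),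
so `t' ≫ uX = uY ≫ t_L`. [cite: LangeRodriguez2022, §3.5.1 Prop. 3.5.1 (p. 65)] [cite: MumfordAV1970, §7 Thm. p. 66 (Remark: categorical quotient)] -/
theorem trace_baseChange_comm_of_isSepQuotient
    (hX : 𝒥X'.diff ≫ uX.hom.hom.hom = (Functor.Monoidal.μIso (bcFunctor K L) X X).hom ≫ (bcFunctor K L).map 𝒥X.diff)
    (hY : 𝒥Y'.diff ≫ uY.hom.hom.hom = (Functor.Monoidal.μIso (bcFunctor K L) Y Y).hom ≫ (bcFunctor K L).map 𝒥Y.diff)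
    {Δ : Type v} [Fintype Δ] (act : Δ → (X ≅ X)) (p : X ⟶ Y)
    (hp' : IsSepQuotient (fun δ => (bcFunctor K L).mapIso (act δ)) ((bcFunctor K L).map p))
    (P₀' : AlgPoints ((bcFunctor K L).obj X) L)
    (t : 𝒥Y.J ⟶ 𝒥X.J) (ht : 𝒥X.pushforward 𝒥Y p ≫ t = ∑ δ, 𝒥X.pushforward 𝒥X (act δ).hom)
    (t' : 𝒥Y'.J ⟶ 𝒥X'.J)
    (ht' : 𝒥X'.pushforward 𝒥Y' ((bcFunctor K L).map p) ≫ t' = ∑ δ, 𝒥X'.pushforward 𝒥X' ((bcFunctor K L).map (act δ).hom)) :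
    t' ≫ uX = uY ≫ AbelianVariety.Hom.baseChange L t :=
  𝒥X.trace_baseChange_comm L 𝒥Y 𝒥X' 𝒥Y' uX uY hX hY act p t ht t' ht'
    fun _ _ _ h => 𝒥X'.eq_of_pushforward_comp_eq 𝒥Y' (fun δ => (bcFunctor K L).mapIso (act δ)) ((bcFunctor K L).map p) hp' P₀' h

/-- **Galois-cover traces are intertwined — over an algebraically closed `L`** (e.g. `L = ℂ`): for `X_L` smooth projective (so with an
`L`-point, ★ `IsSmoothProjective.nonempty_algPoints`) and `p_L` a quotient by the base-changed automorphisms, `t' ≫ uX = uY ≫ t_L`.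
[cite: LangeRodriguez2022, §3.5.1 Prop. 3.5.1 (p. 65)] [cite: Grothendieck1962FGA6, Thm. 3.3 (iii)] -/
theorem trace_baseChange_comm_of_isSmoothProjective [IsAlgClosed L] {n : ℕ}
    (hXL : IsSmoothProjective n ((bcFunctor K L).obj X))
    (hX : 𝒥X'.diff ≫ uX.hom.hom.hom = (Functor.Monoidal.μIso (bcFunctor K L) X X).hom ≫ (bcFunctor K L).map 𝒥X.diff)
    (hY : 𝒥Y'.diff ≫ uY.hom.hom.hom = (Functor.Monoidal.μIso (bcFunctor K L) Y Y).hom ≫ (bcFunctor K L).map 𝒥Y.diff)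
    {Δ : Type v} [Fintype Δ] (act : Δ → (X ≅ X)) (p : X ⟶ Y)
    (hp' : IsSepQuotient (fun δ => (bcFunctor K L).mapIso (act δ)) ((bcFunctor K L).map p))
    (t : 𝒥Y.J ⟶ 𝒥X.J) (ht : 𝒥X.pushforward 𝒥Y p ≫ t = ∑ δ, 𝒥X.pushforward 𝒥X (act δ).hom)
    (t' : 𝒥Y'.J ⟶ 𝒥X'.J)
    (ht' : 𝒥X'.pushforward 𝒥Y' ((bcFunctor K L).map p) ≫ t' = ∑ δ, 𝒥X'.pushforward 𝒥X' ((bcFunctor K L).map (act δ).hom)) :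
    t' ≫ uX = uY ≫ AbelianVariety.Hom.baseChange L t := by
  obtain ⟨P₀'⟩ := hXL.nonempty_algPoints L
  exact 𝒥X.trace_baseChange_comm_of_isSepQuotient L 𝒥Y 𝒥X' 𝒥Y' uX uY hX hY act p hp' P₀' t ht t' ht'

/-! ## §4 Push–pull words: `(t' ≫ Σ_i Nm'_{g_i,L}) ≫ uY = uY ≫ (t ≫ Σ_i Nm_{g_i})_L` -/

/-- **Push–pull words are intertwined**: for a trace pair `(t, t')` intertwined by the comparison maps (§3) and any finite family of curve
maps `g_i : X ⟶ Y`, the endomorphisms `t' ≫ Σ_i Nm'_{(g_i)_L}` of `J(Y_L)` and `t ≫ Σ_i Nm_{g_i}` of `J(Y)` correspond: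
`(t' ≫ Σ_i Nm'_{(g_i)_L}) ≫ uY = uY ≫ (t ≫ Σ_i Nm_{g_i})_L` — the shape of the finite-level Hecke endomorphism `[KgK] = [K:N]⁻¹ · (t ≫ Σ_γ Alb T_γ)`
(★ `AppendixC.HeckeEndomorphismPushPull`). [cite: Lange2023AbelianVarietiesComplex, §4.5.2 (the norm map N_f)] [cite: LangeRodriguez2022, §3.5.1 Prop. 3.5.1 (p. 65)] -/
theorem pushPull_baseChange_comm
    (hX : 𝒥X'.diff ≫ uX.hom.hom.hom = (Functor.Monoidal.μIso (bcFunctor K L) X X).hom ≫ (bcFunctor K L).map 𝒥X.diff)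
    (hY : 𝒥Y'.diff ≫ uY.hom.hom.hom = (Functor.Monoidal.μIso (bcFunctor K L) Y Y).hom ≫ (bcFunctor K L).map 𝒥Y.diff)
    {t : 𝒥Y.J ⟶ 𝒥X.J} {t' : 𝒥Y'.J ⟶ 𝒥X'.J} (htt : t' ≫ uX = uY ≫ AbelianVariety.Hom.baseChange L t)
    {ι : Type*} (s : Finset ι) (g : ι → (X ⟶ Y)) :
    (t' ≫ ∑ i ∈ s, 𝒥X'.pushforward 𝒥Y' ((bcFunctor K L).map (g i))) ≫ uY =
      uY ≫ AbelianVariety.Hom.baseChange L (t ≫ ∑ i ∈ s, 𝒥X.pushforward 𝒥Y (g i)) :=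
  comp_baseChange_comm htt
    (sum_baseChange_comm s fun i _ => 𝒥X.pushforward_baseChange_comm L 𝒥Y 𝒥X' 𝒥Y' uX uY hX hY (g i))

/-- **Integer multiples of push–pull words are intertwined** (`(n • w') ≫ uY = uY ≫ (n • w)_L`), the form in which the honest endomorphism
`ψ_g` with `m⁻¹ ⊗ ψ_g = [KgK]` (★ `heckeEnd_spec`) is compared. [cite: Lange2023AbelianVarietiesComplex, §4.5.2 (the norm map N_f)] -/
theorem zsmul_pushPull_baseChange_comm
    (hX : 𝒥X'.diff ≫ uX.hom.hom.hom = (Functor.Monoidal.μIso (bcFunctor K L) X X).hom ≫ (bcFunctor K L).map 𝒥X.diff)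
    (hY : 𝒥Y'.diff ≫ uY.hom.hom.hom = (Functor.Monoidal.μIso (bcFunctor K L) Y Y).hom ≫ (bcFunctor K L).map 𝒥Y.diff)
    {t : 𝒥Y.J ⟶ 𝒥X.J} {t' : 𝒥Y'.J ⟶ 𝒥X'.J} (htt : t' ≫ uX = uY ≫ AbelianVariety.Hom.baseChange L t)
    {ι : Type*} (s : Finset ι) (g : ι → (X ⟶ Y)) (n : ℤ) :
    (n • (t' ≫ ∑ i ∈ s, 𝒥X'.pushforward 𝒥Y' ((bcFunctor K L).map (g i)))) ≫ uY =
      uY ≫ AbelianVariety.Hom.baseChange L (n • (t ≫ ∑ i ∈ s, 𝒥X.pushforward 𝒥Y (g i))) :=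
  zsmul_baseChange_comm n (𝒥X.pushPull_baseChange_comm L 𝒥Y 𝒥X' 𝒥Y' uX uY hX hY htt s g)

end Jacobian

end Literature.AlgebraicGeometry.Motives

end
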